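import Summits.BirchSwinnertonDyer.BirchSwinnertonDyer.Theorems.ResidualThetaTransportAtTwoSignedMuSeedAtTwoPlusTiltRotation
import HarnessLib

/-!
# Every Lubin–Tate endomorphism `[w]_f` of the tilt curve is `ℤ/3`-graded of weight `1`: `[w](ζt) = ζ·[w](t)`, so `[tⁿ][w] = 0` for `n ≢ 1 (mod 3)`;
# hence the level step `δ_m` of the tilt engine has NO `t^{2N}`-term (`c_m = 0` in the wall formulas)
# (seed lines `norm-field-tilt` / `jet-character-sums`; crux `SignedMuSeedAtTwoPlus` stmt-BirchSwinnertonDyer-21438; Kμ⁺ stmt-BirchSwinnertonDyer-20689)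

Cell `bsd-wall`, width seat `bsd-wall-rtt-p4-w2` g13 (`--supports`, closes nothing).  THEOREMS ONLY; the lines are NOT registered (W-79); BSD is not
proved by this.

`…TiltRotation` (p677430) proved `f_U(ζt) = ζ f_U(t)` (`rescale_formalNeg_subst_formalMul`) and `[ζ]_f = ζt` for `ζ³ = 1`.  By Lubin–Tate
uniqueness the same homogeneity passes to EVERY endomorphism `[w]_f` (`w ∈ A`):

* **`rescale_hom_tiltCurve`** — `rescale ζ ([w]_f) = C ζ · [w]_f` for every `w ∈ A`, `ζ ∈ A` with `ζ³ = 1` (any Lubin–Tate base `A` for `(−2,4)`);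
* `sub_mul_coeff_hom_tiltCurve` — `(ζⁿ − ζ)·[tⁿ][w]_f = 0`; **`coeff_hom_tiltCurve_eq_zero`** — if `ζⁿ − ζ` is a unit then `[tⁿ][w]_f = 0`;
* over `ℤ₄ = 𝒪_{ℚ₂(ζ₃)}` with `z ∈ 𝒪`, `z² + z + 1 = 0`: `isUnit_one_sub_of_cube`, `isUnit_sq_sub_of_cube` (`1 − z`, `z² − z` are units: `(1−z)(1−z²) = 3`,
  `z² − z = −(1 + 2z)`), hence **`coeff_hom_tiltCurve_zFour_eq_zero`**: `[tⁿ][w]_f = 0` whenever `n % 3 ≠ 1` — in particular `[t²][w]_f = 0`,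
  so in `…JetLevelTwoWallComplete.exists_levelStep_delta_shape₃` the constant `c = z₂^N` VANISHES for the engine's `z = [w]‾t`:
  the wall formulas lose their `c·[t^{e−2N}]S²` term on the tilt curve (e.g. `[t⁶⁰]S₂ = ū₁U₂₂² + ū₁²U₃₀`).

References: [LubinTate1965] §1 Thm. 1 (uniqueness); [SilvermanAEC2009] III.10; the cards.
-/

set_option autoImplicit false
-- the Theorems namespace of this sub repeats the summit name by design (D-0017 nested layout)
set_option linter.dupNamespace false

noncomputable section

open scoped Classical IntermediateField
open PowerSeries WeierstrassCurve
open Literature.NumberTheory.EllipticCurves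
open Literature.NumberTheory.GaloisRepresentations
open Summit.BirchSwinnertonDyer.BirchSwinnertonDyer.Theorems.RelativeLubinTate
open Summit.BirchSwinnertonDyer.BirchSwinnertonDyer.Theorems.RelativeLubinTate.ZFour

namespace Summit.BirchSwinnertonDyer.BirchSwinnertonDyer.Theorems.SignedMuAtTwo.Tilt

section Hom

variable {A : Type*} [CommRing A] (hA : LubinTate.IsLTRing (-((2 : ℕ) : A)) (2 ^ 2)) {ζ : A} (hζ : ζ ^ 3 = 1)

include hζ in
/-- **`[w]_f(ζt) = ζ·[w]_f(t)`** for every Lubin–Tate endomorphism of the tilt curve `U = (y² + y = x³)` (`f = f_U = i_U([2]t)`) and every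
`ζ³ = 1`: the series `ζ²·[w](ζt)` has linear term `w` and commutes with `f` (`f` is weight-`1` homogeneous), so it IS `[w]`.
[cite: LubinTate1965, §1 Thm. 1] [cite: SilvermanAEC2009, III.10] -/
theorem rescale_hom_tiltCurve (w : A) :
    PowerSeries.rescale ζ (LubinTate.hom hA (isLTSeries_tiltCurve A) (isLTSeries_tiltCurve A) w) =
      C ζ * LubinTate.hom hA (isLTSeries_tiltCurve A) (isLTSeries_tiltCurve A) w := by
  set f : A⟦X⟧ := (⟨0, 0, 1, 0, 0⟩ : WeierstrassCurve A).formalNeg.subst ((⟨0, 0, 1, 0, 0⟩ : WeierstrassCurve A).formalMul 2) with hf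
  set h : A⟦X⟧ := LubinTate.hom hA (isLTSeries_tiltCurve A) (isLTSeries_tiltCurve A) w with hh
  have hζ2 : (ζ ^ 2) ^ 3 = 1 := by rw [← pow_mul, show 2 * 3 = 3 * 2 from rfl, pow_mul, hζ, one_pow]
  have hf0 : constantCoeff f = 0 :=
    PowerSeries.constantCoeff_subst_eq_zero (constantCoeff_formalMul _ 2) _ (constantCoeff_formalNeg _)
  have hh0 : constantCoeff h = 0 := LubinTate.constantCoeff_hom hA _ _ w
  have hrh0 : constantCoeff (PowerSeries.rescale ζ h) = 0 := by
    rw [← coeff_zero_eq_constantCoeff_apply, coeff_rescale, coeff_zero_eq_constantCoeff_apply, hh0, mul_zero]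
  have hfs : HasSubst f := HasSubst.of_constantCoeff_zero' hf0
  have hrs : HasSubst (PowerSeries.rescale ζ h) := HasSubst.of_constantCoeff_zero' hrh0
  -- homogeneity of `f`: `f(c·s) = c·f(s)` for `c³ = 1`
  have hfζ : ∀ {c : A}, c ^ 3 = 1 → PowerSeries.rescale c f = C c * f := fun hc =>
    rescale_formalNeg_subst_formalMul (⟨0, 0, 1, 0, 0⟩ : WeierstrassCurve A) rfl rfl rfl hc 2
  -- the candidate `G = ζ²·[w](ζt)` is `[w]` by uniqueness
  have hG : C (ζ ^ 2) * PowerSeries.rescale ζ h = h := by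
    refine LubinTate.eq_hom hA (isLTSeries_tiltCurve A) (isLTSeries_tiltCurve A) ?_ ?_ ?_
    · rw [map_mul, hrh0, mul_zero]
    · rw [coeff_C_mul, coeff_rescale, pow_one, LubinTate.coeff_one_hom, ← mul_assoc, ← pow_succ, hζ, one_mul]
    · -- `f(G) = ζ²·f([w](ζt)) = ζ²·([w]∘f)(ζt)… = G(f)`
      have hC : ∀ (a : A) (s : A⟦X⟧), (C a).subst s = C a := fun a s => PowerSeries.subst_C a
      have hL : PowerSeries.subst (C (ζ ^ 2) * PowerSeries.rescale ζ h) f =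
          C (ζ ^ 2) * PowerSeries.subst (PowerSeries.rescale ζ h) f := by
        rw [← PowerSeries.smul_eq_C_mul, subst_smul_eq_rescale_subst _ _ hrh0, hfζ hζ2, PowerSeries.subst_mul hrs, hC]
      have hR : PowerSeries.subst f (C (ζ ^ 2) * PowerSeries.rescale ζ h) =
          C (ζ ^ 2) * PowerSeries.subst f (PowerSeries.rescale ζ h) := by
        rw [PowerSeries.subst_mul hfs, hC]
      -- `f([w](ζt)) = ([w](f))(ζt) = [w](f(ζt)) = [w](ζ f(t)) = (rescale ζ [w])(f)`
      have hmid : PowerSeries.subst (PowerSeries.rescale ζ h) f = PowerSeries.subst f (PowerSeries.rescale ζ h) := by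
        rw [PowerSeries.rescale_eq_subst, ← PowerSeries.subst_comp_subst_apply (HasSubst.of_constantCoeff_zero' hh0)
          (HasSubst.smul_X' ζ), LubinTate.subst_hom hA _ _ w, PowerSeries.subst_comp_subst_apply hfs (HasSubst.smul_X' ζ),
          ← PowerSeries.rescale_eq_subst, hfζ hζ, ← PowerSeries.smul_eq_C_mul, subst_smul_eq_rescale_subst _ _ hf0,
          PowerSeries.rescale_eq_subst]
      rw [hL, hR, hmid]
  have hC3 : C ζ * C (ζ ^ 2) = (1 : A⟦X⟧) := by rw [← map_mul, ← pow_succ', hζ, map_one]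
  calc PowerSeries.rescale ζ h = C ζ * (C (ζ ^ 2) * PowerSeries.rescale ζ h) := by rw [← mul_assoc, hC3, one_mul]
    _ = C ζ * h := by rw [hG]

include hζ in
/-- `(ζⁿ − ζ)·[tⁿ][w]_f = 0` for every `n`. [folklore] -/
theorem sub_mul_coeff_hom_tiltCurve (w : A) (n : ℕ) :
    (ζ ^ n - ζ) * coeff n (LubinTate.hom hA (isLTSeries_tiltCurve A) (isLTSeries_tiltCurve A) w) = 0 := by
  have h := congrArg (coeff n) (rescale_hom_tiltCurve hA hζ w)
  rw [coeff_rescale, coeff_C_mul] at h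
  linear_combination h

include hζ in
/-- **`[tⁿ][w]_f = 0` whenever `ζⁿ − ζ` is a unit** (i.e. `n ≢ 1 (mod 3)` over a base where `1 − ζ` and `ζ² − ζ` are units). [folklore] -/
theorem coeff_hom_tiltCurve_eq_zero (w : A) {n : ℕ} (hu : IsUnit (ζ ^ n - ζ)) :
    coeff n (LubinTate.hom hA (isLTSeries_tiltCurve A) (isLTSeries_tiltCurve A) w) = 0 :=
  (hu.mul_right_eq_zero).mp (sub_mul_coeff_hom_tiltCurve hA hζ w n)

end Hom

/-! ## Over `ℤ₄ = 𝒪_{ℚ₂(ζ₃)}` -/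

section ZFour

variable {ζ : PadicAlgCl 2} (hζ : ζ ^ 2 + ζ + 1 = 0)

/-- `z² + z + 1 = 0 ⟹ z³ = 1`. [folklore] -/
theorem pow_three_eq_one_of_quad {R : Type*} [CommRing R] {z : R} (hz : z ^ 2 + z + 1 = 0) : z ^ 3 = 1 := by
  linear_combination (z - 1) * hz

/-- `1 + 2a` is a unit of `𝒪 = 𝒪_{ℚ₂(ζ₃)}` (`2 ∈ 𝔪`). [folklore] -/
theorem isUnit_one_add_two_mul (a : LubinTate.unitBall (↥ℚ_[2]⟮ζ⟯)) : IsUnit (1 + 2 * a : LubinTate.unitBall (↥ℚ_[2]⟮ζ⟯)) := by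
  have hmem : (-(2 * a) : LubinTate.unitBall (↥ℚ_[2]⟮ζ⟯)) ∈ nonunits (LubinTate.unitBall (↥ℚ_[2]⟮ζ⟯)) := by
    rw [← IsLocalRing.mem_maximalIdeal]
    have h2 := two_mem_maximalIdeal (ζ := ζ)
    rw [Nat.cast_ofNat] at h2
    exact neg_mem (Ideal.mul_mem_right a _ h2)
  have h := IsLocalRing.isUnit_one_sub_self_of_mem_nonunits _ hmem
  rwa [sub_neg_eq_add] at h

/-- For `z ∈ 𝒪` with `z² + z + 1 = 0`: `z² − z = −(1 + 2z)` is a unit. [folklore] -/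
theorem isUnit_sq_sub_of_quad {z : LubinTate.unitBall (↥ℚ_[2]⟮ζ⟯)} (hz : z ^ 2 + z + 1 = 0) : IsUnit (z ^ 2 - z) := by
  have h : z ^ 2 - z = -(1 + 2 * z) := by linear_combination hz
  rw [h]; exact (isUnit_one_add_two_mul z).neg

/-- For `z ∈ 𝒪` with `z² + z + 1 = 0`: `1 − z` is a unit (`(1 − z)·(1 − z²) = 3 = 1 + 2`). [folklore] -/
theorem isUnit_one_sub_of_quad {z : LubinTate.unitBall (↥ℚ_[2]⟮ζ⟯)} (hz : z ^ 2 + z + 1 = 0) : IsUnit (1 - z) := by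
  have h3 : (1 - z) * (1 - z ^ 2) = 1 + 2 * 1 := by linear_combination (z - 2) * hz
  exact isUnit_of_mul_isUnit_left (h3 ▸ isUnit_one_add_two_mul (ζ := ζ) 1)

include hζ in
/-- **On the tilt curve over `ℤ₄`, `[tⁿ][w]_f = 0` for every `n` with `n % 3 ≠ 1`** (`z ∈ 𝒪` a primitive cube root of unity, `z² + z + 1 = 0`).
In particular `[t²][w]_f = 0`: the engine's `z = [w]‾t` has `z₂ = 0`, so `c = z₂^N = 0` in the wall formulas. [folklore] -/
theorem coeff_hom_tiltCurve_zFour_eq_zero {z : LubinTate.unitBall (↥ℚ_[2]⟮ζ⟯)} (hz : z ^ 2 + z + 1 = 0)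
    (w : LubinTate.unitBall (↥ℚ_[2]⟮ζ⟯)) {n : ℕ} (hn : n % 3 ≠ 1) :
    coeff n (LubinTate.hom (isLTRing_unitBall_adjoin_zeta hζ)
      (isLTSeries_tiltCurve (LubinTate.unitBall (↥ℚ_[2]⟮ζ⟯))) (isLTSeries_tiltCurve (LubinTate.unitBall (↥ℚ_[2]⟮ζ⟯))) w) = 0 := by
  have hz3 : z ^ 3 = 1 := pow_three_eq_one_of_quad hz
  refine coeff_hom_tiltCurve_eq_zero (isLTRing_unitBall_adjoin_zeta hζ) hz3 w ?_
  -- `zⁿ = z^{n % 3}`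
  rw [← Nat.div_add_mod n 3, pow_add, pow_mul, hz3, one_pow, one_mul]
  have hlt : n % 3 < 3 := Nat.mod_lt n (by norm_num)
  interval_cases h : n % 3
  · rw [pow_zero]; exact isUnit_one_sub_of_quad hz
  · exact absurd rfl hn
  · exact isUnit_sq_sub_of_quad hz

end ZFour

end Summit.BirchSwinnertonDyer.BirchSwinnertonDyer.Theorems.SignedMuAtTwo.Tilt

end
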